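import Literature.Geometry.Lorentzian.CauchyHypersurfaceOpensIntersection
import Literature.Geometry.Lorentzian.CauchyDevelopmentRestrict
import Literature.Geometry.Lorentzian.CauchyDevelopmentOneJet
import Literature.Geometry.Lorentzian.IsometricImmersionRigidity
import HarnessLib

/-!
# Two isometric immersions of common globally hyperbolic developments agree on the intersection
# (Sbierski 2016, §3.1, Corollary 8)

J. Sbierski, *On the existence of a maximal Cauchy development for the Einstein equations: a
dezornification*, Ann. Henri Poincaré 17 (2016) = arXiv:1309.7591, §3.1, Corollary 8 (arXiv
numbering): *"Let `(M, g)` be a globally hyperbolic, time oriented Lorentzian manifold with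
Cauchy surface `Σ` and `(M', g')` another time oriented Lorentzian manifold. Moreover, say
`U₁, U₂ ⊆ M` are open and globally hyperbolic with Cauchy surface `Σ`, and `ψᵢ : Uᵢ → M'`,
`i = 1, 2`, are time orientation preserving isometric immersions that agree on `Σ`. Then `ψ₁` and
`ψ₂` agree on `U₁ ∩ U₂`."* This is the well-definedness of the glued isometric immersion
`ψ(p) := ψ_α(p)` for `p ∈ U_α` in the construction of the maximal common globally hyperbolic
development as the union of all CGHDs (Thm. 10, *"By Corollary 8 this is well-defined"*).

Here `M` is the spacetime of a Cauchy development `𝒟` of the data `D` on `X`, `Σ = ι(X)`, the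
open sub-spacetimes carry the restricted metric and time orientation (`LorentzianMetric.restrict`,
`TimeOrientation.restrict`, with the discharged restriction facts `contMDiff_restrict_holds`), the
target `M'` is the spacetime of any data embedding `𝒮'` of the same data, and "agree on `Σ`" is
`ψᵢ ∘ ι = ι'` (`DataEmbedding.embedOpens`): `CauchyDevelopment.eq_of_isIsometricImmersion_opens`.

Proof, following the printed one. *"Since `ψ₁` and `ψ₂` agree on `Σ`, their differentials agree
on `Σ` if evaluated on vectors tangent to `Σ`"* — `DataEmbedding.mfderiv_comp_embedOpens_apply`;
*"since the isometric immersions preserve the time orientation, they both map the future normal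
of `Σ` onto the future normal of `ψ₁(Σ) = ψ₂(Σ)`"* — `DataEmbedding.mfderiv_opens_normal`
(uniqueness of the future unit normal, `TimeOrientation.eq_of_isFutureUnitNormal` of
`CauchyDevelopmentOneJet`); *"Thus, the differentials of `ψ₁` and `ψ₂` agree on `Σ`"* —
`DataEmbedding.mfderiv_opens_eq_of_comp_embedOpens_eq` (`T_{ι x} M = dι(T_x X) ⊕ ℝ ν`,
`exists_eq_mfderiv_embed_add_smul_normal`); *"The corollary now follows from Lemma 7"* — the
rigidity of isometric immersions on a **connected** domain
(`PseudoRiemannianMetric.IsIsometricImmersion.eq_of_mfderiv_eq`, `IsometricImmersionRigidity`),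
applied to the restrictions of `ψ₁`, `ψ₂` to the open sub-spacetime `W = U₁ ∩ U₂`, which is
connected by `CauchyDevelopment.isConnected_inter_opens` (`CauchyHypersurfaceOpensIntersection`:
the sentence the printed proof leaves implicit). Restriction along the inclusion of opens
`W ≤ Uᵢ` preserves isometric immersions and time-orientation preservation
(`LorentzianMetric.isIsometricImmersion_comp_inclusion`,
`TimeOrientation.preservesTimeOrientation_comp_inclusion`; `d(inclusion) = id`,
`mfderiv_inclusion`).

All results proved; no definitions, no named facts (D-0026).

## References

* J. Sbierski, Ann. Henri Poincaré 17 (2016) 301–329 = arXiv:1309.7591v3, §3.1, Lemma 7,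
  Corollary 8, Theorem 10.
* B. O'Neill, *Semi-Riemannian geometry with applications to relativity*, 1983, Ch. 3,
  Prop. 3.62 (rigidity of local isometries), Ch. 1, pp. 3–7 (open submanifolds).
* Y. Choquet-Bruhat, R. Geroch, Comm. Math. Phys. 14 (1969) 329–335, proof of Thm. 3, p. 332
  ("ψ and ψ̃ coincide wherever they are both defined").
-/

noncomputable section

open Bundle Set Function Filter TopologicalSpace Topology Manifold
open scoped Manifold ContDiff Topology

namespace Literature.Geometry.Lorentzian

universe u

/-! ### The inclusion of opens: differential, isometric immersions, time orientation -/

section Inclusion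

variable {E : Type*} [NormedAddCommGroup E] [NormedSpace ℝ E] {H : Type*} [TopologicalSpace H]
  {I : ModelWithCorners ℝ E H} {n : ℕ∞ω} {M : Type*} [TopologicalSpace M] [ChartedSpace H M]
  {E' : Type*} [NormedAddCommGroup E'] [NormedSpace ℝ E'] {H' : Type*} [TopologicalSpace H']
  {I' : ModelWithCorners ℝ E' H'} {N : Type*} [TopologicalSpace N] [ChartedSpace H' N]

/-- The inclusion of opens `U ≤ V` is differentiable. [folklore] -/
theorem mdifferentiableAt_inclusion {U V : Opens M} (h : U ≤ V) (y : U) :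
    MDifferentiableAt I I (Opens.inclusion h) y :=
  (contMDiff_inclusion (n := 1) h y).mdifferentiableAt one_ne_zero

/-- **The inclusion of opens `U ≤ V` has identity differential** (both inclusions into `M` have
identity differential, `mfderiv_subtypeVal`, and `val_V ∘ inclusion = val_U`). Lee 2013,
Prop. 3.9 (`T_p U = T_p M`). [folklore] -/
theorem mfderiv_inclusion {U V : Opens M} (h : U ≤ V) (y : U) :
    mfderiv I I (Opens.inclusion h) y = ContinuousLinearMap.id ℝ E := by
  have hc := mfderiv_comp y (hasMFDerivAt_subtypeVal (I' := I) (Opens.inclusion h y)).mdifferentiableAt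
    (mdifferentiableAt_inclusion h y)
  change mfderiv I I (Subtype.val : U → M) y = _ at hc
  rw [mfderiv_subtypeVal, mfderiv_subtypeVal] at hc
  rw [← ContinuousLinearMap.id_comp (mfderiv I I (Opens.inclusion h) y)]
  exact hc.symm

/-- **Chain rule for the restriction to a smaller open subset**: the differential of
`f ∘ inclusion` at `y ∈ U` is the differential of `f : V → N` at `y` (`d(inclusion) = id`).
[folklore] -/
theorem mfderiv_comp_inclusion {U V : Opens M} (h : U ≤ V) {f : V → N} {y : U}
    (hf : MDifferentiableAt I I' f (Opens.inclusion h y)) :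
    mfderiv I I' (f ∘ Opens.inclusion h) y = mfderiv I I' f (Opens.inclusion h y) := by
  rw [mfderiv_comp y hf (mdifferentiableAt_inclusion h y), mfderiv_inclusion]
  exact ContinuousLinearMap.comp_id _

variable [IsManifold I ∞ M] [IsManifold I' ∞ N]

/-- **Restricting an isometric immersion of an open sub-spacetime to a smaller open subset gives
an isometric immersion** (for the restricted metrics `g|_V`, `g|_U`, `U ≤ V`): smoothness of the
inclusion (`contMDiff_inclusion`) and `d(inclusion) = id`. O'Neill 1983, Ch. 3, p. 58 and Ch. 1,
pp. 3–7. [cite: ONeillSemiRiemannian1983, Ch. 3, p. 58] -/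
theorem LorentzianMetric.isIsometricImmersion_comp_inclusion (hn : n ≠ 0)
    (g : LorentzianMetric I n M)
    (hres : PseudoRiemannianMetric.contMDiff_restrict (I := I) (n := n) (M := M))
    (gN : PseudoRiemannianMetric I' n E' (TangentSpace I' : N → Type _)) {U V : Opens M}
    (h : U ≤ V) {ψ : V → N} (hψ : (g.restrict hres V).IsIsometricImmersion gN ψ) :
    (g.restrict hres U).IsIsometricImmersion gN (ψ ∘ Opens.inclusion h) := by
  refine ⟨hψ.1.comp (contMDiff_inclusion h), fun y ↦ ?_⟩
  have hψd : MDifferentiableAt I I' ψ (Opens.inclusion h y) := (hψ.1 _).mdifferentiableAt hn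
  ext v w
  rw [pullbackBilin_apply, mfderiv_comp_inclusion h hψd]
  have h2 := congrArg (fun b ↦ b v w) (hψ.2 (Opens.inclusion h y))
  simp only [pullbackBilin_apply] at h2
  exact h2

/-- **Restricting a time-orientation preserving map of an open sub-spacetime to a smaller open
subset preserves the time orientation** (`d(inclusion) = id`, and the restricted orienting field
of `U` is that of `V` at the same point). O'Neill 1983, Ch. 5, p. 145. [cite: ONeillSemiRiemannian1983, Ch. 5, p. 145] -/
theorem TimeOrientation.preservesTimeOrientation_comp_inclusion {g : LorentzianMetric I n M}
    (τ : TimeOrientation g)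
    (hres : PseudoRiemannianMetric.contMDiff_restrict (I := I) (n := n) (M := M))
    (hτ : τ.contMDiff_restrict) {gN : LorentzianMetric I' n N} (τN : TimeOrientation gN)
    {U V : Opens M} (h : U ≤ V) {ψ : V → N}
    (hψd : ∀ y, MDifferentiableAt I I' ψ y)
    (hψ : (τ.restrict hres hτ V).PreservesTimeOrientation ψ τN) :
    (τ.restrict hres hτ U).PreservesTimeOrientation (ψ ∘ Opens.inclusion h) τN := fun y ↦ by
  rw [mfderiv_comp_inclusion h (hψd _)]
  exact hψ (Opens.inclusion h y)

end Inclusion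

/-! ### The one-jet of an isometric immersion of a sub-development along the data hypersurface -/

section Developments

variable {n : ℕ} {X : Type u} [TopologicalSpace X] [ChartedSpace (EuclideanSpace ℝ (Fin n)) X]
  [IsManifold (𝓡 n) ∞ X] [ConnectedSpace X] {D : InitialDataSet (𝓡 n) X}

namespace DataEmbedding

variable (𝒮 𝒮' : DataEmbedding D)

/-- **Chain rule along the data hypersurface, for a map of an open sub-spacetime `U ⊇ ι(X)`**:
if `ψ ∘ ι = ι'` for a differentiable `ψ : U → M'`, then `dψ (dι v) = dι' v` (*"since `ψ₁` and
`ψ₂` agree on `Σ`, their differentials agree on `Σ` if evaluated on vectors tangent to `Σ`"*,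
Sbierski 2016, §3.1, proof of Cor. 8; the version of `mfderiv_comp_embed_apply` for opens).
[cite: Sbierski2016AHP, §3.1, proof of Cor. 8 (arXiv numbering)] -/
theorem mfderiv_comp_embedOpens_apply {U : Opens 𝒮.carrier} (hι : ∀ x, 𝒮.embed x ∈ U)
    {ψ : U → 𝒮'.carrier} (hψ : MDifferentiable (𝓡 (n + 1)) (𝓡 (n + 1)) ψ)
    (hψι : ψ ∘ 𝒮.embedOpens U hι = 𝒮'.embed) (x : X) (v : TangentSpace (𝓡 n) x) :
    mfderiv (𝓡 (n + 1)) (𝓡 (n + 1)) ψ (𝒮.embedOpens U hι x)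
        (mfderiv (𝓡 n) (𝓡 (n + 1)) 𝒮.embed x v) =
      mfderiv (𝓡 n) (𝓡 (n + 1)) 𝒮'.embed x v := by
  have h := mfderiv_comp x (hψ (𝒮.embedOpens U hι x)) (𝒮.mdifferentiableAt_embedOpens U hι x)
  rw [hψι] at h
  rw [← 𝒮.mfderiv_embedOpens_apply U hι x v, congrArg (fun L ↦ L v) h]
  rfl

/-- **An isometric immersion of an open sub-spacetime `U ⊇ ι(X)` commuting with the data
embeddings maps the future unit normal to the future unit normal**: if `ψ : U → M'` is an
isometric immersion for `g|_U` preserving the time orientation `τ|_U` with `ψ ∘ ι = ι'`, then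
`dψ (ν x) = ν' x` — `dψ (ν x)` has square `-1`, is normal to `dψ (dι T_x X) = dι'(T_x X)` and
future-directed (`PreservesTimeOrientation.isFutureDirected_mfderiv`), and the future unit normal
is unique (`TimeOrientation.eq_of_isFutureUnitNormal`). *"Since the isometric immersions preserve
the time orientation, they both map the future normal of `Σ` onto the future normal of
`ψ₁(Σ) = ψ₂(Σ)`"* (Sbierski 2016, §3.1, proof of Cor. 8; the version of `mfderiv_normal` for
opens). [cite: Sbierski2016AHP, §3.1, proof of Cor. 8 (arXiv numbering)] -/
theorem mfderiv_opens_normal {U : Opens 𝒮.carrier} (hι : ∀ x, 𝒮.embed x ∈ U)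
    {ψ : U → 𝒮'.carrier}
    (hψi : (𝒮.metric.restrict PseudoRiemannianMetric.contMDiff_restrict_holds U).IsIsometricImmersion
      𝒮'.metric.toPseudoRiemannianMetric ψ)
    (hψτ : (𝒮.timeOrientation.restrict PseudoRiemannianMetric.contMDiff_restrict_holds
      𝒮.timeOrientation.contMDiff_restrict_holds U).PreservesTimeOrientation ψ 𝒮'.timeOrientation)
    (hψι : ψ ∘ 𝒮.embedOpens U hι = 𝒮'.embed) (x : X) :
    mfderiv (𝓡 (n + 1)) (𝓡 (n + 1)) ψ (𝒮.embedOpens U hι x) (𝒮.normal x) = 𝒮'.normal x := by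
  have hψd : MDifferentiable (𝓡 (n + 1)) (𝓡 (n + 1)) ψ := hψi.1.mdifferentiable (by simp)
  have hx : ψ (𝒮.embedOpens U hι x) = 𝒮'.embed x := congrFun hψι x
  have key : ∀ u w : TangentSpace (𝓡 (n + 1)) (𝒮.embed x),
      𝒮'.metric.val (ψ (𝒮.embedOpens U hι x))
        (mfderiv (𝓡 (n + 1)) (𝓡 (n + 1)) ψ (𝒮.embedOpens U hι x) u)
        (mfderiv (𝓡 (n + 1)) (𝓡 (n + 1)) ψ (𝒮.embedOpens U hι x) w) =
      𝒮.metric.val (𝒮.embed x) u w := fun u w ↦ by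
    have h := congrArg (fun b ↦ b u w) (hψi.2 (𝒮.embedOpens U hι x))
    simp only [pullbackBilin_apply] at h
    exact h
  refine 𝒮'.timeOrientation.eq_of_isFutureUnitNormal hx.symm
    (mfderiv (𝓡 n) (𝓡 (n + 1)) 𝒮'.embed x)
    (fun v hv ↦ 𝒮'.val_mfderiv_embed_pos x hv) (finrank_tangentSpace_add_one x)
    (𝒮'.isFutureUnitNormal.1.1 x) (𝒮'.isFutureUnitNormal.1.2 x) (𝒮'.isFutureUnitNormal.2 x)
    (fun v ↦ ?_) ?_ ?_
  · rw [← 𝒮.mfderiv_comp_embedOpens_apply 𝒮' hι hψd hψι x v, key]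
    exact 𝒮.isFutureUnitNormal.1.1 x v
  · rw [key]
    exact 𝒮.isFutureUnitNormal.1.2 x
  · exact hψτ.isFutureDirected_mfderiv hψi.2 (𝒮.isFutureUnitNormal.2 x)

/-- The differential of an isometric immersion `ψ : U → M'` of an open sub-spacetime
`U ⊇ ι(X)` commuting with the data embeddings, on a vector decomposed along
`T_{ι x} M = dι(T_x X) ⊕ ℝ ν`: `dψ (dι v + a ν) = dι' v + a ν'` (`mfderiv_comp_embedOpens_apply`,
`mfderiv_opens_normal`, linearity). [cite: Sbierski2016AHP, §3.1, proof of Cor. 8 (arXiv numbering)] -/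
theorem mfderiv_opens_apply_add_smul {U : Opens 𝒮.carrier} (hι : ∀ x, 𝒮.embed x ∈ U)
    {ψ : U → 𝒮'.carrier}
    (hψi : (𝒮.metric.restrict PseudoRiemannianMetric.contMDiff_restrict_holds U).IsIsometricImmersion
      𝒮'.metric.toPseudoRiemannianMetric ψ)
    (hψτ : (𝒮.timeOrientation.restrict PseudoRiemannianMetric.contMDiff_restrict_holds
      𝒮.timeOrientation.contMDiff_restrict_holds U).PreservesTimeOrientation ψ 𝒮'.timeOrientation)
    (hψι : ψ ∘ 𝒮.embedOpens U hι = 𝒮'.embed) (x : X) (v : TangentSpace (𝓡 n) x) (a : ℝ) :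
    mfderiv (𝓡 (n + 1)) (𝓡 (n + 1)) ψ (𝒮.embedOpens U hι x)
        (mfderiv (𝓡 n) (𝓡 (n + 1)) 𝒮.embed x v + a • 𝒮.normal x) =
      mfderiv (𝓡 n) (𝓡 (n + 1)) 𝒮'.embed x v + a • 𝒮'.normal x := by
  have hψd : MDifferentiable (𝓡 (n + 1)) (𝓡 (n + 1)) ψ := hψi.1.mdifferentiable (by simp)
  have h3 : mfderiv (𝓡 (n + 1)) (𝓡 (n + 1)) ψ (𝒮.embedOpens U hι x)
        (mfderiv (𝓡 n) (𝓡 (n + 1)) 𝒮.embed x v + a • 𝒮.normal x) =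
      mfderiv (𝓡 (n + 1)) (𝓡 (n + 1)) ψ (𝒮.embedOpens U hι x)
          (mfderiv (𝓡 n) (𝓡 (n + 1)) 𝒮.embed x v) +
        a • mfderiv (𝓡 (n + 1)) (𝓡 (n + 1)) ψ (𝒮.embedOpens U hι x) (𝒮.normal x) := by
    exact ((mfderiv (𝓡 (n + 1)) (𝓡 (n + 1)) ψ (𝒮.embedOpens U hι x)).map_add _ _).trans
      (congrArg _ ((mfderiv (𝓡 (n + 1)) (𝓡 (n + 1)) ψ (𝒮.embedOpens U hι x)).map_smul _ _))
  rw [h3, 𝒮.mfderiv_comp_embedOpens_apply 𝒮' hι hψd hψι x v, 𝒮.mfderiv_opens_normal 𝒮' hι hψi hψτ hψι x]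
  rfl

/-- **The differential along the data hypersurface of an isometric immersion of an open
sub-spacetime `U ⊇ ι(X)` commuting with the data embeddings is determined by the data**: two
such maps `ψ : U → M'`, `ψ' : U' → M'` (time-orientation preserving isometric immersions for the
restricted structures with `ψ ∘ ι = ι' = ψ' ∘ ι`, possibly on different opens `U`, `U'`) have the
same differential at every point `ι x` — both send `dι v ↦ dι' v` (`mfderiv_comp_embedOpens_apply`)
and `ν ↦ ν'` (`mfderiv_opens_normal`), and `T_{ι x} M = dι(T_x X) ⊕ ℝ ν`
(`exists_eq_mfderiv_embed_add_smul_normal`). *"Thus, the differentials of `ψ₁` and `ψ₂` agree on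
`Σ`"* (Sbierski 2016, §3.1, proof of Cor. 8). [cite: Sbierski2016AHP, §3.1, proof of Cor. 8 (arXiv numbering)] -/
theorem mfderiv_opens_eq_of_comp_embedOpens_eq {U U' : Opens 𝒮.carrier}
    (hι : ∀ x, 𝒮.embed x ∈ U) (hι' : ∀ x, 𝒮.embed x ∈ U')
    {ψ : U → 𝒮'.carrier} {ψ' : U' → 𝒮'.carrier}
    (hψi : (𝒮.metric.restrict PseudoRiemannianMetric.contMDiff_restrict_holds U).IsIsometricImmersion
      𝒮'.metric.toPseudoRiemannianMetric ψ)
    (hψτ : (𝒮.timeOrientation.restrict PseudoRiemannianMetric.contMDiff_restrict_holds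
      𝒮.timeOrientation.contMDiff_restrict_holds U).PreservesTimeOrientation ψ 𝒮'.timeOrientation)
    (hψι : ψ ∘ 𝒮.embedOpens U hι = 𝒮'.embed)
    (hψ'i : (𝒮.metric.restrict PseudoRiemannianMetric.contMDiff_restrict_holds U').IsIsometricImmersion
      𝒮'.metric.toPseudoRiemannianMetric ψ')
    (hψ'τ : (𝒮.timeOrientation.restrict PseudoRiemannianMetric.contMDiff_restrict_holds
      𝒮.timeOrientation.contMDiff_restrict_holds U').PreservesTimeOrientation ψ' 𝒮'.timeOrientation)
    (hψ'ι : ψ' ∘ 𝒮.embedOpens U' hι' = 𝒮'.embed) (x : X)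
    (w : TangentSpace (𝓡 (n + 1)) (𝒮.embed x)) :
    mfderiv (𝓡 (n + 1)) (𝓡 (n + 1)) ψ (𝒮.embedOpens U hι x) w =
      mfderiv (𝓡 (n + 1)) (𝓡 (n + 1)) ψ' (𝒮.embedOpens U' hι' x) w := by
  obtain ⟨v, hw⟩ := 𝒮.exists_eq_mfderiv_embed_add_smul_normal x w
  rw [hw, 𝒮.mfderiv_opens_apply_add_smul 𝒮' hι hψi hψτ hψι,
    𝒮.mfderiv_opens_apply_add_smul 𝒮' hι' hψ'i hψ'τ hψ'ι]

end DataEmbedding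

/-! ### Corollary 8: agreement on the intersection -/

namespace CauchyDevelopment

/-- **Sbierski 2016, Corollary 8: two isometric immersions of common globally hyperbolic
developments agree on the intersection.** Let `𝒟` be a Cauchy development of `D` with spacetime
`M` and data hypersurface `ι(X)`, `𝒮'` a data embedding of `D` with spacetime `M'`, and
`U₁, U₂ ⊆ M` open subsets containing `ι(X)` in each of which `ι(X)` is a Cauchy hypersurface
(for `g|_{Uᵢ}`, `τ|_{Uᵢ}`). If `ψᵢ : Uᵢ → M'` (`i = 1, 2`) are time-orientation preserving
isometric immersions of the open sub-spacetimes with `ψᵢ ∘ ι = ι'`, then `ψ₁ = ψ₂` on `U₁ ∩ U₂`.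
Proof as printed: the differentials of `ψ₁`, `ψ₂` agree along `ι(X)`
(`DataEmbedding.mfderiv_opens_eq_of_comp_embedOpens_eq`), and the rigidity of isometric
immersions (Lemma 7 = O'Neill's Prop. 3.62,
`PseudoRiemannianMetric.IsIsometricImmersion.eq_of_mfderiv_eq`) applies to the restrictions of
`ψ₁`, `ψ₂` to the open sub-spacetime `U₁ ∩ U₂`, which is **connected**
(`CauchyDevelopment.isConnected_inter_opens`). [cite: Sbierski2016AHP, §3.1, Cor. 8 (arXiv numbering)] -/
theorem eq_of_isIsometricImmersion_opens (𝒟 : CauchyDevelopment D) (𝒮' : DataEmbedding D)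
    {U₁ U₂ : Opens 𝒟.carrier} (h₁ : ∀ x, 𝒟.embed x ∈ U₁) (h₂ : ∀ x, 𝒟.embed x ∈ U₂)
    (hU₁ : (𝒟.metric.restrict PseudoRiemannianMetric.contMDiff_restrict_holds U₁).IsCauchyHypersurface
      (𝒟.timeOrientation.restrict PseudoRiemannianMetric.contMDiff_restrict_holds
        𝒟.timeOrientation.contMDiff_restrict_holds U₁) (Subtype.val ⁻¹' range 𝒟.embed))
    (hU₂ : (𝒟.metric.restrict PseudoRiemannianMetric.contMDiff_restrict_holds U₂).IsCauchyHypersurface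
      (𝒟.timeOrientation.restrict PseudoRiemannianMetric.contMDiff_restrict_holds
        𝒟.timeOrientation.contMDiff_restrict_holds U₂) (Subtype.val ⁻¹' range 𝒟.embed))
    {ψ₁ : U₁ → 𝒮'.carrier} {ψ₂ : U₂ → 𝒮'.carrier}
    (hψ₁i : (𝒟.metric.restrict PseudoRiemannianMetric.contMDiff_restrict_holds U₁).IsIsometricImmersion
      𝒮'.metric.toPseudoRiemannianMetric ψ₁)
    (hψ₁τ : (𝒟.timeOrientation.restrict PseudoRiemannianMetric.contMDiff_restrict_holds
      𝒟.timeOrientation.contMDiff_restrict_holds U₁).PreservesTimeOrientation ψ₁ 𝒮'.timeOrientation)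
    (hψ₁ι : ψ₁ ∘ 𝒟.embedOpens U₁ h₁ = 𝒮'.embed)
    (hψ₂i : (𝒟.metric.restrict PseudoRiemannianMetric.contMDiff_restrict_holds U₂).IsIsometricImmersion
      𝒮'.metric.toPseudoRiemannianMetric ψ₂)
    (hψ₂τ : (𝒟.timeOrientation.restrict PseudoRiemannianMetric.contMDiff_restrict_holds
      𝒟.timeOrientation.contMDiff_restrict_holds U₂).PreservesTimeOrientation ψ₂ 𝒮'.timeOrientation)
    (hψ₂ι : ψ₂ ∘ 𝒟.embedOpens U₂ h₂ = 𝒮'.embed)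
    {p : 𝒟.carrier} (hp₁ : p ∈ U₁) (hp₂ : p ∈ U₂) : ψ₁ ⟨p, hp₁⟩ = ψ₂ ⟨p, hp₂⟩ := by
  -- the open sub-spacetime `W = U₁ ∩ U₂` is connected
  set W : Opens 𝒟.carrier := U₁ ⊓ U₂ with hWdef
  haveI : ConnectedSpace W :=
    isConnected_iff_connectedSpace.mp (𝒟.isConnected_inter_opens h₁ h₂ hU₁ hU₂)
  have hW : ∀ x, 𝒟.embed x ∈ W := fun x ↦ ⟨h₁ x, h₂ x⟩
  have hψ₁d : MDifferentiable (𝓡 (n + 1)) (𝓡 (n + 1)) ψ₁ := hψ₁i.1.mdifferentiable (by simp)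
  have hψ₂d : MDifferentiable (𝓡 (n + 1)) (𝓡 (n + 1)) ψ₂ := hψ₂i.1.mdifferentiable (by simp)
  -- the restrictions `φᵢ = ψᵢ|_W`
  set φ₁ : W → 𝒮'.carrier := ψ₁ ∘ Opens.inclusion inf_le_left with hφ₁
  set φ₂ : W → 𝒮'.carrier := ψ₂ ∘ Opens.inclusion inf_le_right with hφ₂
  have hφ₁i : (𝒟.metric.restrict PseudoRiemannianMetric.contMDiff_restrict_holds W).IsIsometricImmersion
      𝒮'.metric.toPseudoRiemannianMetric φ₁ :=
    𝒟.metric.isIsometricImmersion_comp_inclusion (by simp) PseudoRiemannianMetric.contMDiff_restrict_holds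
      𝒮'.metric.toPseudoRiemannianMetric inf_le_left hψ₁i
  have hφ₂i : (𝒟.metric.restrict PseudoRiemannianMetric.contMDiff_restrict_holds W).IsIsometricImmersion
      𝒮'.metric.toPseudoRiemannianMetric φ₂ :=
    𝒟.metric.isIsometricImmersion_comp_inclusion (by simp) PseudoRiemannianMetric.contMDiff_restrict_holds
      𝒮'.metric.toPseudoRiemannianMetric inf_le_right hψ₂i
  have hφ₁τ : (𝒟.timeOrientation.restrict PseudoRiemannianMetric.contMDiff_restrict_holds
      𝒟.timeOrientation.contMDiff_restrict_holds W).PreservesTimeOrientation φ₁ 𝒮'.timeOrientation :=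
    𝒟.timeOrientation.preservesTimeOrientation_comp_inclusion
      PseudoRiemannianMetric.contMDiff_restrict_holds 𝒟.timeOrientation.contMDiff_restrict_holds
      𝒮'.timeOrientation inf_le_left (fun y ↦ hψ₁d y) hψ₁τ
  have hφ₂τ : (𝒟.timeOrientation.restrict PseudoRiemannianMetric.contMDiff_restrict_holds
      𝒟.timeOrientation.contMDiff_restrict_holds W).PreservesTimeOrientation φ₂ 𝒮'.timeOrientation :=
    𝒟.timeOrientation.preservesTimeOrientation_comp_inclusion
      PseudoRiemannianMetric.contMDiff_restrict_holds 𝒟.timeOrientation.contMDiff_restrict_holds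
      𝒮'.timeOrientation inf_le_right (fun y ↦ hψ₂d y) hψ₂τ
  have hφ₁ι : φ₁ ∘ 𝒟.embedOpens W hW = 𝒮'.embed := funext fun x ↦ congrFun hψ₁ι x
  have hφ₂ι : φ₂ ∘ 𝒟.embedOpens W hW = 𝒮'.embed := funext fun x ↦ congrFun hψ₂ι x
  -- the one-jets of `φ₁`, `φ₂` agree at a point of `ι(X)`
  obtain ⟨x₀⟩ : Nonempty X := inferInstance
  have hp : φ₁ (𝒟.embedOpens W hW x₀) = φ₂ (𝒟.embedOpens W hW x₀) :=
    (congrFun hφ₁ι x₀).trans (congrFun hφ₂ι x₀).symm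
  have hd : mfderiv (𝓡 (n + 1)) (𝓡 (n + 1)) φ₁ (𝒟.embedOpens W hW x₀) =
      mfderiv (𝓡 (n + 1)) (𝓡 (n + 1)) φ₂ (𝒟.embedOpens W hW x₀) :=
    ContinuousLinearMap.ext fun w ↦
      𝒟.toDataEmbedding.mfderiv_opens_eq_of_comp_embedOpens_eq 𝒮' hW hW hφ₁i hφ₁τ hφ₁ι hφ₂i hφ₂τ
        hφ₂ι x₀ w
  -- rigidity on the connected `W`
  have key : φ₁ = φ₂ :=
    hφ₁i.eq_of_mfderiv_eq (WithTop.coe_le_coe.mpr le_top) rfl hφ₂i hp hd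
  exact congrFun key ⟨p, hp₁, hp₂⟩

end CauchyDevelopment

end Developments

end Literature.Geometry.Lorentzian

end
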